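import Summits.AtomisticToContinuum.FouriersLaw.Theses.OddSectorIrreversibility

/-!
# Sketch — crux ideas on `TapLeakBound` (P, stmt-AtomisticToContinuum-15159), round 1, ideator k = 1

Card `friction-mass-tap-resolvent` (H1 side of the planned split P ⇐ H1 × C′):
* `MassiveTapIdentity` — FIRST LEMMA (fixed `N`, exact): the commuted, MASSIVE Poisson equation
  `(γ − L) ∂_{p_b}u = ∂_{p_b}J + ∂_{q_b}u` paired with `∂_{p_b}u` in `L²(μ_T)`:
  `γ‖v‖² + γT‖∂_{p_b}v‖² + γT‖∂_{p_{b'}}v‖² = ⟨v, ∂_{p_b}J⟩ + ⟨v, ∂_{q_b}u⟩`, `v = ∂_{p_b}u`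
  (kit j016222: exact to 1e-15 in the harmonic member, N = 4…256, six parameter points).
* `ContactPositionSensitivity` (CPS) — the single first-order, depth-0 residual the lever leaves:
  `‖∂_{q_b}u‖²_{μ_T} ≤ C(|⟨u,J⟩_{μ_T}| + Z)`.
* `BoundaryHermiteRegularityK1` — H1 as described in the route header (rev 17; the filed child's text lives in
  the rchoice seat's children.json, not readable from this hub — replace by it verbatim at crux-plan time).
* `HermiteOfPosition` — the reduction shape `MassiveTapIdentity → CPS → H1` the card claims (via (★★) of the card).
Card `stationary-leak-covariance` (restatement / successor line, kin of `drained-leak-open-pairing` on crux 15120):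
* `LeakCovarianceIdentity` — FIRST LEMMA (fixed `N`, exact, kernel-level): the contact-summed, time-integrated leak
  of the TYPED closed witness as three open-vs-closed discrepancy covariances.
* `OpenClosedDiscrepancyCone` — the one capped N-uniform input (= `shadowDefect`/E3* of the 15120 cards, order 3).
* `PlateauLeakBound` — what WitnessGlue actually consumes, with the corrector NORM as prefactor (E1 scale).
Props only (signatures that must elaborate); nothing is proved here.
-/

noncomputable section

open MeasureTheory Filter Set
open scoped BigOperators NNReal

namespace Summit.AtomisticToContinuum.FouriersLaw.Cruxes.TapLeakBound.IdeatorK1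

open Literature.MathematicalPhysics.KineticTheory.HeatConduction
open Summit.AtomisticToContinuum.FouriersLaw.Theses.OddSectorIrreversibility

/-! ### Card `friction-mass-tap-resolvent` -/

/-- FIRST LEMMA (fixed `N`, exact). For the equilibrium open chain (`T_L = T_R = T`) and a classical solution
`u ∈ C³` of `L u = −J_tot`, the tap derivative `v := ∂_{p_b}u` at contact `b` (the other contact `b' ≠ b`)
solves the MASSIVE Poisson equation `(γ − L)v = ∂_{p_b}J + ∂_{q_b}u` (commutators `[∂_{p_b}, A] = ∂_{q_b}`,
`[∂_{p_b}, S_b] = −γ∂_{p_b}`, separable `H`), and pairing it with `v` against `μ_T = e^{−H/T}dqdp`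
(Liouville part `μ_T`-antisymmetric, each tap `⟨f, S_c f⟩ = −γT‖∂_{p_c}f‖²`) gives
`γ∫v² + γT∫(∂_{p_b}v)² + γT∫(∂_{p_{b'}}v)² = ∫ v·∂_{p_b}J + ∫ v·∂_{q_b}u`.
Integrability hypotheses as `MemLp`; the cutoff justification is the tree's Kubo-calculus pattern
(`integral_chi_liouville_antisymm`, `integral_chi_mul_bathOp`). -/
def MassiveTapIdentity : Prop :=
  ∀ ω₂ lam β γ : ℝ, 0 < ω₂ → 0 ≤ lam → 0 ≤ β → 0 < γ → ∀ T : ℝ, 0 < T →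
    ∀ (N : ℕ) (b b' : Fin N) (u : PhaseSpace N → ℝ), b.val = 0 → b'.val = N - 1 → b ≠ b' →
      let P := pinnedChain ω₂ lam β γ
      let μT : Measure (PhaseSpace N) :=
        volume.withDensity (fun x : PhaseSpace N => ENNReal.ofReal (Real.exp (-(P.hamiltonian N x) / T)))
      let J : PhaseSpace N → ℝ := fun z => ∑ k : Fin N, P.bondCurrent N k z
      let v : PhaseSpace N → ℝ := partialP b u
      ContDiff ℝ 3 u →
      (∀ x, P.generator N T T u x = -J x) →
      MemLp v 2 μT → MemLp (partialP b v) 2 μT → MemLp (partialP b' v) 2 μT →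
      MemLp (partialQ b u) 2 μT → MemLp (fun x => P.generator N T T v x) 2 μT →
        γ * ∫ x, (v x) ^ 2 ∂μT + γ * T * ∫ x, (partialP b v x) ^ 2 ∂μT
            + γ * T * ∫ x, (partialP b' v x) ^ 2 ∂μT
          = (∫ x, v x * partialP b J x ∂μT) + ∫ x, v x * partialQ b u x ∂μT

/-- CPS — CONTACT POSITION SENSITIVITY (the card's single N-uniform residual on the corrector side; first
order, depth 0, tap scale): for the Kubo corrector `u = u_N` (characterised exactly as in `TapLeakBound`:
`C¹`, `L²(μ_T)`, a.e.-limit of the finite-horizon correctors), `∫(∂_{q_b}u)² dμ_T ≤ C(|∫u·J dμ_T| + Z)` at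
both contacts. Harmonic member: TRUE with an `N`-independent constant (kit j016222: `γT‖∂_{q_0}u‖²/⟨u,J⟩ → 1.99`
at `γ = 1`, `1.14…3.60` for `γ = 0.2…2`, `T`-independent). -/
def ContactPositionSensitivity : Prop :=
  ∀ ω₂ lam β γ : ℝ, 0 < ω₂ → 0 < lam → 0 < β → 0 < γ → ∀ T : ℝ, 0 < T → ∃ C : ℝ,
    ∀ (N : ℕ) (b : Fin N) (u : PhaseSpace N → ℝ), (b.val = 0 ∨ b.val = N - 1) →
      let P := pinnedChain ω₂ lam β γ
      let μT : Measure (PhaseSpace N) :=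
        volume.withDensity (fun x : PhaseSpace N => ENNReal.ofReal (Real.exp (-(P.hamiltonian N x) / T)))
      let J : PhaseSpace N → ℝ := fun z => ∑ k : Fin N, P.bondCurrent N k z
      ContDiff ℝ 1 u → MemLp u 2 μT →
      (∀ᵐ x ∂μT, Tendsto (fun τ : ℝ => ∫ t in Set.Ioc (0 : ℝ) τ,
          (∫ y, J y ∂(P.transitionKernel N T T t.toNNReal x))) atTop (nhds (u x))) →
        MemLp (partialQ b u) 2 μT ∧
        ∫ x, (partialQ b u x) ^ 2 ∂μT
          ≤ C * (|∫ x, u x * J x ∂μT| + ∫ x, Real.exp (-(P.hamiltonian N x) / T) ∂volume)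

/-- H1 as the route header (rev 17) describes the child `BoundaryHermiteRegularity` of P (to be replaced by the
filed child's text verbatim): for `u` as above (and `C²`), with `u⁺ = (u + u∘Θ)/2` and the Ornstein–Uhlenbeck tap
operator `𝒩_b f = −T ∂_{p_b}∂_{p_b} f + p_b ∂_{p_b} f`, `𝒩_b u⁺ ∈ L²(μ_T)` and
`∫(𝒩_b u⁺)² dμ_T ≤ C(|∫u·J dμ_T| + Z)`. -/
def BoundaryHermiteRegularityK1 : Prop :=
  ∀ ω₂ lam β γ : ℝ, 0 < ω₂ → 0 < lam → 0 < β → 0 < γ → ∀ T : ℝ, 0 < T → ∃ C : ℝ,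
    ∀ (N : ℕ) (b : Fin N) (u : PhaseSpace N → ℝ), (b.val = 0 ∨ b.val = N - 1) →
      let P := pinnedChain ω₂ lam β γ
      let μT : Measure (PhaseSpace N) :=
        volume.withDensity (fun x : PhaseSpace N => ENNReal.ofReal (Real.exp (-(P.hamiltonian N x) / T)))
      let J : PhaseSpace N → ℝ := fun z => ∑ k : Fin N, P.bondCurrent N k z
      let ue : PhaseSpace N → ℝ := fun x => (u x + u (x.1, -x.2)) / 2
      let Nue : PhaseSpace N → ℝ := fun x => -(T * partialP b (partialP b ue) x) + x.2 b * partialP b ue x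
      ContDiff ℝ 2 u → MemLp u 2 μT →
      (∀ᵐ x ∂μT, Tendsto (fun τ : ℝ => ∫ t in Set.Ioc (0 : ℝ) τ,
          (∫ y, J y ∂(P.transitionKernel N T T t.toNNReal x))) atTop (nhds (u x))) →
        MemLp Nue 2 μT ∧
        ∫ x, (Nue x) ^ 2 ∂μT ≤ C * (|∫ x, u x * J x ∂μT| + ∫ x, Real.exp (-(P.hamiltonian N x) / T) ∂volume)

/-- The reduction the card claims (shape; proof = (★) + the resolvent bound `‖(γ − L)⁻¹‖ ≤ 1/γ` on `L²(μ_T)`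
+ the landed tap identity + one-dimensional Gaussian bookkeeping `‖p_b f‖ ≤ 2T‖∂_{p_b}f‖ + √T‖f‖`):
H1 follows from CPS at fixed order, with `∂_{p_{b±1}}u` never appearing. -/
def HermiteOfPosition : Prop :=
  MassiveTapIdentity → ContactPositionSensitivity → BoundaryHermiteRegularityK1

/-! ### Card `stationary-leak-covariance` -/

/-- FIRST LEMMA (fixed `N`, exact, kernel level; no path space). For the Kubo corrector `u` (a.e.-limit of the
finite-horizon correctors, `L²(μ_T)`), every bond `i`, `s ≥ 0`, with `P_s` the equilibrium OPEN kernels,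
`Φ_s` the zero-friction (closed-flow) kernels, `Θ(q,p) = (q,−p)`, `u⁻ = (u − u∘Θ)/2`:
`2(⟨u⁻, j_i∘Φ_s⟩ − ⟨u⁻, j_i⟩) = [⟨j_i∘Φ_s, P_s u⟩ − ⟨u, j_i⟩] + ⟨u∘Θ, P_s j_i − j_i∘Φ_s⟩
   + ∫₀^s [⟨P_r J, j_i∘Φ_s⟩ − ⟨J, P_{s−r} j_i⟩] dr`  (all pairings in `L²(μ_T)`),
from: Dynkin `u = ∫₀^s P_r J dr + P_s u`, kernel detailed balance `P_s^* = Θ P_s Θ`, `Θ`-invariance of `μ_T`,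
oddness of `J`, `j_i`. Each bracket is an OPEN-vs-CLOSED discrepancy covariance (see `PlateauLeakBound`). -/
def LeakCovarianceIdentity : Prop :=
  ∀ ω₂ lam β γ : ℝ, 0 < ω₂ → 0 < lam → 0 < β → 0 < γ → ∀ T : ℝ, 0 < T →
    ∀ (N : ℕ) (i : Fin N) (u : PhaseSpace N → ℝ) (s : ℝ), 0 ≤ s →
      let P := pinnedChain ω₂ lam β γ
      let P₀ := pinnedChain ω₂ lam β 0
      let μT : Measure (PhaseSpace N) :=
        volume.withDensity (fun x : PhaseSpace N => ENNReal.ofReal (Real.exp (-(P.hamiltonian N x) / T)))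
      let J : PhaseSpace N → ℝ := fun z => ∑ k : Fin N, P.bondCurrent N k z
      let j : PhaseSpace N → ℝ := P.bondCurrent N i
      let Ps : ℝ → (PhaseSpace N → ℝ) → PhaseSpace N → ℝ :=
        fun r f x => ∫ y, f y ∂(P.transitionKernel N T T r.toNNReal x)
      let js : PhaseSpace N → ℝ := fun x => ∫ y, j y ∂(P₀.transitionKernel N T T s.toNNReal x)
      let uo : PhaseSpace N → ℝ := fun x => (u x - u (x.1, -x.2)) / 2
      let uT : PhaseSpace N → ℝ := fun x => u (x.1, -x.2)
      ContDiff ℝ 1 u → MemLp u 2 μT →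
      (∀ᵐ x ∂μT, Tendsto (fun τ : ℝ => ∫ t in Set.Ioc (0 : ℝ) τ,
          (∫ y, J y ∂(P.transitionKernel N T T t.toNNReal x))) atTop (nhds (u x))) →
        2 * ((∫ x, uo x * js x ∂μT) - ∫ x, uo x * j x ∂μT)
          = ((∫ x, js x * Ps s u x ∂μT) - ∫ x, u x * j x ∂μT)
            + (∫ x, uT x * (Ps s j x - js x) ∂μT)
            + ∫ r in Set.Ioc (0 : ℝ) s, ((∫ x, Ps r J x * js x ∂μT) - ∫ x, J x * Ps (s - r) j x ∂μT)

/-- The ONE capped N-uniform input of the successor line (= `shadowDefect` of crux-15120 card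
drained-leak-open-pairing, = E3* `OpenClosedInfluenceCone` of tap-form-cauchy-schwarz, bond level, filed here at
ORDER 3 on squares): the joint-kernel mean square of the open-vs-closed discrepancy of the bond current,
`∫∫ (j_i(y) − j_i(Φ_s x))² P_s(x,dy) μ_T(dx) ≤ C (1 + (d − s/a))^{−3} Z` for `s ≤ a d`, `d` = distance of bond `i`
to the NEARER contact. A priori `≤ 4‖j_i‖²` (capped, amplifier-immune); measured: linear front `1/a ≈ 0.6–0.7`,
super-exponential tail, N = 32…256 (kit j015712 E3*, j015793 DS). -/
def OpenClosedDiscrepancyCone : Prop :=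
  ∀ ω₂ lam β γ : ℝ, 0 < ω₂ → 0 < lam → 0 < β → 0 < γ → ∀ T : ℝ, 0 < T → ∃ a C : ℝ, 0 < a ∧
    ∀ (N : ℕ) (i : Fin N) (s : ℝ), 0 ≤ s →
      let P := pinnedChain ω₂ lam β γ
      let P₀ := pinnedChain ω₂ lam β 0
      let μT : Measure (PhaseSpace N) :=
        volume.withDensity (fun x : PhaseSpace N => ENNReal.ofReal (Real.exp (-(P.hamiltonian N x) / T)))
      let j : PhaseSpace N → ℝ := P.bondCurrent N i
      let js : PhaseSpace N → ℝ := fun x => ∫ y, j y ∂(P₀.transitionKernel N T T s.toNNReal x)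
      let d : ℕ := min i.val (N - 2 - i.val)
      s ≤ a * (d : ℝ) →
        ∫ x, (∫ y, (j y - js x) ^ 2 ∂(P.transitionKernel N T T s.toNNReal x)) ∂μT
          ≤ C * (∫ x, Real.exp (-(P.hamiltonian N x) / T) ∂volume) / (1 + ((d : ℝ) - s / a)) ^ (3 : ℝ)

/-- What `WitnessGlue` actually consumes of P (contact-summed, time-INTEGRATED, near distance), restated with the
corrector NORM as prefactor (E1 scale) instead of the tap budget: `|⟨u⁻, j_i∘Φ_s⟩ − ⟨u⁻, j_i⟩| ≤
C·(‖u‖_{L²(μ_T)} + s·‖J‖_{L²(μ_T)})·√Z·(1 + (d − s/a))^{−3/2}` for `s ≤ a d`. From `LeakCovarianceIdentity` +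
three Cauchy–Schwarz steps + `OpenClosedDiscrepancyCone`; with E1 (`‖u‖ ≤ √(C₁)N√Z`) the witness bookkeeping closes
at order 3 with no `√D_N` bootstrap (card §Arithmetic). -/
def PlateauLeakBound : Prop :=
  ∀ ω₂ lam β γ : ℝ, 0 < ω₂ → 0 < lam → 0 < β → 0 < γ → ∀ T : ℝ, 0 < T → ∃ a C : ℝ, 0 < a ∧
    ∀ (N : ℕ) (i : Fin N) (u : PhaseSpace N → ℝ) (s : ℝ), 0 ≤ s →
      let P := pinnedChain ω₂ lam β γ
      let P₀ := pinnedChain ω₂ lam β 0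
      let μT : Measure (PhaseSpace N) :=
        volume.withDensity (fun x : PhaseSpace N => ENNReal.ofReal (Real.exp (-(P.hamiltonian N x) / T)))
      let J : PhaseSpace N → ℝ := fun z => ∑ k : Fin N, P.bondCurrent N k z
      let j : PhaseSpace N → ℝ := P.bondCurrent N i
      let js : PhaseSpace N → ℝ := fun x => ∫ y, j y ∂(P₀.transitionKernel N T T s.toNNReal x)
      let uo : PhaseSpace N → ℝ := fun x => (u x - u (x.1, -x.2)) / 2
      let d : ℕ := min i.val (N - 2 - i.val)
      ContDiff ℝ 1 u → MemLp u 2 μT →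
      (∀ᵐ x ∂μT, Tendsto (fun τ : ℝ => ∫ t in Set.Ioc (0 : ℝ) τ,
          (∫ y, J y ∂(P.transitionKernel N T T t.toNNReal x))) atTop (nhds (u x))) →
      s ≤ a * (d : ℝ) →
        |(∫ x, uo x * js x ∂μT) - ∫ x, uo x * j x ∂μT|
          ≤ C * (Real.sqrt (∫ x, (u x) ^ 2 ∂μT) + s * Real.sqrt (∫ x, (J x) ^ 2 ∂μT))
              * Real.sqrt (∫ x, Real.exp (-(P.hamiltonian N x) / T) ∂volume)
              / (1 + ((d : ℝ) - s / a)) ^ (3 / 2 : ℝ)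

/-- Shape of the successor glue step: the consumed leak bound follows from the identity and the one cone. -/
def PlateauLeakOfCone : Prop :=
  LeakCovarianceIdentity → OpenClosedDiscrepancyCone → PlateauLeakBound

end Summit.AtomisticToContinuum.FouriersLaw.Cruxes.TapLeakBound.IdeatorK1

end
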